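import Summits.ValiantsHypothesis.ValiantsHypothesis.Theorems.DefinabilityGapAffineRung
import HarnessLib

/-!
# DefinabilityGap — the LOW-DEGREE RUNG of the planted Kabanets–Impagliazzo permanent generator (unconditional)

Route `route-ValiantsHypothesis-DefinabilityGap` (decomp-valiant cycle 1, lens 5), supporting the hitting item
`KIPlantedHitting` (stmt-ValiantsHypothesis-23547) and its weakly-skew / read-once children.

MAIN THEOREM `kiPer_hits_lowDegree`: if `2k < m` then NO nonzero polynomial of total degree `≤ k` in the `q(m)³`
coordinates annihilates `G_m = (per_m(y|S_c))_{c ∈ 𝔽_q³}` — for every FIXED degree the planted generator is eventually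
hitting, with arbitrary supports (all `q³ ≫ m²` variables allowed). The case `k = 1` is the affine rung
(`DefinabilityGapAffineRung.kiPer_hits_affine`). Proof (leading monomials): fix the lexicographic monomial order after
transporting the seed variables `𝔽_q × 𝔽_q` to `Fin (q·q)`; the leading exponent `d_c` of `per_m(y|S_c)` is a permutation
pattern — `m` cells of the curve `S_c`, multiplicity one. For an exponent `e` of `D` the leading exponent of
`∏_c per_m(y|S_c)^{e_c}` is `Σ_c e_c d_c`, and this weighted sum DETERMINES `e` when `|e| ≤ k < m/2`: summing the multiset
over the `m` cells of `d_{c₀}` gives `≥ m·e_{c₀}` on one side and `≤ m·e'_{c₀} + 2k` on the other, because two curves share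
`≤ 2` cells (`isNWDesign_polyBlock 2`). Hence the lex-maximal `Σ_c e_c d_c` over the support of `D` is attained once, its
coefficient in `D ∘ G_m` is the (nonzero) leading coefficient of a single term, and `D ∘ G_m ≠ 0`. 0 sorry.
-/

noncomputable section

open MvPolynomial
open Literature.Computability.AlgebraicComplexity Literature.Computability.MetaComplexity

namespace Summit.ValiantsHypothesis.ValiantsHypothesis.Theorems.DefinabilityGapAffineRung

/-! ## 1. The combinatorial core: block-weighted sums of permutation patterns determine the weights -/

/-- One-sided form. `d c` are `0/1`-vectors with `m`-element supports inside blocks `B c` meeting pairwise in `≤ 2`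
points; if `Σ_c e_c • d_c = Σ_c e'_c • d_c` with `|e'| ≤ k` and `2k < m` then `e ≤ e'` pointwise. [this file] -/
theorem weight_le_of_sum_smul_eq {ι α : Type*} [DecidableEq α]
    (d : ι → α →₀ ℕ) (B : ι → Finset α) {m k : ℕ}
    (hval : ∀ c x, d c x ≤ 1) (hsupp : ∀ c, (d c).support ⊆ B c)
    (hcard : ∀ c, (d c).support.card = m) (hB : ∀ c c', c ≠ c' → (B c ∩ B c').card ≤ 2)
    (hkm : 2 * k < m) {e e' : ι →₀ ℕ} (he' : (e'.sum fun _ n => n) ≤ k)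
    (h : (e.sum fun c n => n • d c) = e'.sum fun c n => n • d c) (c₀ : ι) : e c₀ ≤ e' c₀ := by
  classical
  set S₀ := (d c₀).support with hS₀
  have hx : ∀ x, (∑ c ∈ e.support, e c * d c x) = ∑ c ∈ e'.support, e' c * d c x := by
    intro x
    have h1 := congrArg (fun F : α →₀ ℕ => F x) h
    simp only [Finsupp.sum_apply, Finsupp.smul_apply, smul_eq_mul] at h1
    exact h1
  have hsum₀ : ∑ x ∈ S₀, d c₀ x = m := by
    rw [Finset.sum_congr rfl (g := fun _ => 1), Finset.sum_const, smul_eq_mul, mul_one, hcard]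
    intro x hx
    have h1 := hval c₀ x
    have h2 := Finsupp.mem_support_iff.1 hx
    omega
  have hsum₂ : ∀ c, c ≠ c₀ → ∑ x ∈ S₀, d c x ≤ 2 := by
    intro c hc
    calc ∑ x ∈ S₀, d c x ≤ ∑ x ∈ S₀, (if x ∈ (d c).support then 1 else 0) :=
          Finset.sum_le_sum fun x _ => by
            split_ifs with hx
            · exact hval c x
            · exact (Finsupp.notMem_support_iff.1 hx).le
      _ = (S₀.filter (· ∈ (d c).support)).card := by rw [Finset.sum_boole, Nat.cast_id]
      _ = (S₀ ∩ (d c).support).card := by rw [Finset.filter_mem_eq_inter]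
      _ ≤ (B c₀ ∩ B c).card := Finset.card_le_card (Finset.inter_subset_inter (hsupp c₀) (hsupp c))
      _ ≤ 2 := hB c₀ c (Ne.symm hc)
  have hlow : e c₀ * m ≤ ∑ x ∈ S₀, ∑ c ∈ e.support, e c * d c x := by
    rw [← hsum₀, Finset.mul_sum]
    apply Finset.sum_le_sum
    intro x _
    by_cases hc₀ : c₀ ∈ e.support
    · exact Finset.single_le_sum (f := fun c => e c * d c x) (fun c _ => Nat.zero_le _) hc₀
    · rw [Finsupp.notMem_support_iff.1 hc₀, zero_mul]
      exact Nat.zero_le _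
  have hup : ∑ x ∈ S₀, ∑ c ∈ e'.support, e' c * d c x ≤ e' c₀ * m + 2 * k := by
    rw [Finset.sum_comm]
    simp_rw [← Finset.mul_sum]
    calc ∑ c ∈ e'.support, e' c * ∑ x ∈ S₀, d c x
        ≤ ∑ c ∈ e'.support, e' c * ((if c = c₀ then m else 0) + 2) := by
          apply Finset.sum_le_sum
          intro c _
          apply Nat.mul_le_mul_left
          split_ifs with hc
          · subst hc
            rw [hsum₀]
            omega
          · rw [zero_add]
            exact hsum₂ c hc
      _ = (∑ c ∈ e'.support, (if c = c₀ then e' c * m else 0)) + 2 * ∑ c ∈ e'.support, e' c := by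
          rw [Finset.mul_sum, ← Finset.sum_add_distrib]
          apply Finset.sum_congr rfl
          intro c _
          split_ifs <;> ring
      _ ≤ e' c₀ * m + 2 * k := by
          apply add_le_add
          · rw [Finset.sum_ite_eq']
            split_ifs <;> simp
          · exact Nat.mul_le_mul_left 2 he'
  have hchain : e c₀ * m ≤ e' c₀ * m + 2 * k := by
    calc e c₀ * m ≤ ∑ x ∈ S₀, ∑ c ∈ e.support, e c * d c x := hlow
      _ = ∑ x ∈ S₀, ∑ c ∈ e'.support, e' c * d c x := Finset.sum_congr rfl fun x _ => hx x
      _ ≤ e' c₀ * m + 2 * k := hup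
  by_contra hlt
  push Not at hlt
  have h1 : (e' c₀ + 1) * m ≤ e c₀ * m := Nat.mul_le_mul_right m hlt
  nlinarith

/-- Two-sided form: under `|e|, |e'| ≤ k < m/2` the weighted sum `Σ_c e_c • d_c` determines `e`. [this file] -/
theorem weights_eq_of_sum_smul_eq {ι α : Type*} [DecidableEq α]
    (d : ι → α →₀ ℕ) (B : ι → Finset α) {m k : ℕ}
    (hval : ∀ c x, d c x ≤ 1) (hsupp : ∀ c, (d c).support ⊆ B c)
    (hcard : ∀ c, (d c).support.card = m) (hB : ∀ c c', c ≠ c' → (B c ∩ B c').card ≤ 2)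
    (hkm : 2 * k < m) {e e' : ι →₀ ℕ} (he : (e.sum fun _ n => n) ≤ k) (he' : (e'.sum fun _ n => n) ≤ k)
    (h : (e.sum fun c n => n • d c) = e'.sum fun c n => n • d c) : e = e' :=
  Finsupp.ext fun c => le_antisymm (weight_le_of_sum_smul_eq d B hval hsupp hcard hB hkm he' h c)
    (weight_le_of_sum_smul_eq d B hval hsupp hcard hB hkm he h.symm c)

/-! ## 2. The generator transported to linearly ordered seed variables, and its lex-leading exponents -/

/-- `G_m(c) ≠ 0`. [this file] -/
theorem kiPer_ne_zero (m : ℕ) (c : Fin 3 → Fin (qOf m)) : kiPer m c ≠ 0 := by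
  intro h
  have h1 := coeff_diagMonomial_kiPer_self m c
  rw [h, coeff_zero] at h1
  exact zero_ne_one h1

/-- The seed variables `𝔽_q × 𝔽_q` renumbered as `Fin (q·q)` (a linear order for the monomial order). [this file] -/
def seedEquiv (m : ℕ) : (Fin (qOf m) × Fin (qOf m)) ≃ Fin (qOf m * qOf m) := finProdFinEquiv

/-- The transported generator coordinate. [this file] -/
def kiPerT (m : ℕ) (c : Fin 3 → Fin (qOf m)) : MvPolynomial (Fin (qOf m * qOf m)) ℂ :=
  rename (seedEquiv m) (kiPer m c)

/-- The transported coordinate is `per_m` renamed along `seedEquiv ∘ cellEmb`. [this file] -/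
theorem kiPerT_eq (m : ℕ) (c : Fin 3 → Fin (qOf m)) :
    kiPerT m c = rename ((seedEquiv m) ∘ (cellEmb m c)) (perPoly (Fin m) ℂ) := by
  rw [kiPerT, kiPer_eq_rename_cellEmb, rename_rename]

/-- The transported coordinate is nonzero. [this file] -/
theorem kiPerT_ne_zero (m : ℕ) (c : Fin 3 → Fin (qOf m)) : kiPerT m c ≠ 0 := fun h =>
  kiPer_ne_zero m c (rename_injective _ (seedEquiv m).injective (by rw [map_zero]; exact h))

/-- The lexicographic monomial order on the transported seed variables. [this file] -/
def lexOrd (m : ℕ) : MonomialOrder (Fin (qOf m * qOf m)) := MonomialOrder.lex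

/-- The lex-leading exponent `d_c` of the transported `per_m(y|S_c)`. [this file] -/
def leadExp (m : ℕ) (c : Fin 3 → Fin (qOf m)) : Fin (qOf m * qOf m) →₀ ℕ := (lexOrd m).degree (kiPerT m c)

/-- `d_c` is a transported permutation pattern. [this file] -/
theorem exists_leadExp_eq (m : ℕ) (c : Fin 3 → Fin (qOf m)) : ∃ ρ : Equiv.Perm (Fin m),
    leadExp m c = Finsupp.mapDomain ((seedEquiv m) ∘ (cellEmb m c)) (permMonomial ρ) := by
  have hmem : leadExp m c ∈ (kiPerT m c).support := (lexOrd m).degree_mem_support (kiPerT_ne_zero m c)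
  rw [mem_support_iff, kiPerT_eq] at hmem
  obtain ⟨u, hu, hc⟩ := coeff_rename_ne_zero _ _ _ hmem
  obtain ⟨ρ, rfl⟩ := exists_permMonomial_eq_of_coeff_perPoly_ne_zero ℂ hc
  exact ⟨ρ, hu.symm⟩

/-- A transported permutation pattern is `0/1`-valued. [folklore] -/
theorem mapDomain_permMonomial_apply_le_one {n β : Type*} [Fintype n] [DecidableEq n] [DecidableEq β]
    {f : n × n → β} (hf : Function.Injective f) (ρ : Equiv.Perm n) (x : β) :
    Finsupp.mapDomain f (permMonomial ρ) x ≤ 1 := by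
  by_cases hx : x ∈ Set.range f
  · obtain ⟨a, rfl⟩ := hx
    rw [Finsupp.mapDomain_apply hf, permMonomial_apply]
    split_ifs <;> simp
  · rw [Finsupp.mapDomain_notin_range _ _ hx]
    exact Nat.zero_le _

/-- The block of coordinate `c` in transported variables. [this file] -/
def blockT (m : ℕ) (c : Fin 3 → Fin (qOf m)) : Finset (Fin (qOf m * qOf m)) :=
  (Finset.univ.map (quadDesign m c)).map (seedEquiv m).toEmbedding

/-- `d_c` is `0/1`-valued. [this file] -/
theorem leadExp_apply_le_one (m : ℕ) (c : Fin 3 → Fin (qOf m)) (x : Fin (qOf m * qOf m)) :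
    leadExp m c x ≤ 1 := by
  obtain ⟨ρ, h⟩ := exists_leadExp_eq m c
  rw [h]
  exact mapDomain_permMonomial_apply_le_one ((seedEquiv m).injective.comp (cellEmb m c).injective) ρ x

/-- `d_c` lives inside the block of `c`. [this file] -/
theorem support_leadExp_subset (m : ℕ) (c : Fin 3 → Fin (qOf m)) : (leadExp m c).support ⊆ blockT m c := by
  obtain ⟨ρ, h⟩ := exists_leadExp_eq m c
  rw [h, Finsupp.mapDomain_support_of_injective ((seedEquiv m).injective.comp (cellEmb m c).injective)]
  intro x hx
  obtain ⟨y, -, rfl⟩ := Finset.mem_image.1 hx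
  refine Finset.mem_map.2 ⟨cellEmb m c y, ?_, rfl⟩
  exact Finset.mem_map.2 ⟨permPad (sq_le_qOf m) y, Finset.mem_univ _, rfl⟩

/-- `d_c` has `m` cells. [this file] -/
theorem card_support_leadExp (m : ℕ) (c : Fin 3 → Fin (qOf m)) : (leadExp m c).support.card = m := by
  obtain ⟨ρ, h⟩ := exists_leadExp_eq m c
  rw [h, Finsupp.mapDomain_support_of_injective ((seedEquiv m).injective.comp (cellEmb m c).injective),
    Finset.card_image_of_injective _ ((seedEquiv m).injective.comp (cellEmb m c).injective),
    card_support_permMonomial, Fintype.card_fin]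

/-- Two transported blocks share `≤ 2` cells (quadratic-curve design). [this file] -/
theorem card_blockT_inter (m : ℕ) {c c' : Fin 3 → Fin (qOf m)} (h : c ≠ c') :
    (blockT m c ∩ blockT m c').card ≤ 2 := by
  classical
  rw [blockT, blockT, ← Finset.map_inter, Finset.card_map]
  exact quadDesign_isNWDesign m h

/-- The leading exponent of the `e`-th power product: `Σ_c e_c • d_c`. [this file] -/
def leadSum (m : ℕ) (e : (Fin 3 → Fin (qOf m)) →₀ ℕ) : Fin (qOf m * qOf m) →₀ ℕ :=
  e.sum fun c n => n • leadExp m c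

/-- `leadSum` is injective on exponents of weight `≤ k` once `2k < m`. [this file] -/
theorem leadSum_inj {m k : ℕ} (hkm : 2 * k < m) {e e' : (Fin 3 → Fin (qOf m)) →₀ ℕ}
    (he : (e.sum fun _ n => n) ≤ k) (he' : (e'.sum fun _ n => n) ≤ k) (h : leadSum m e = leadSum m e') :
    e = e' := by
  classical
  exact weights_eq_of_sum_smul_eq (leadExp m) (blockT m) (leadExp_apply_le_one m) (support_leadExp_subset m)
    (card_support_leadExp m) (fun c c' hcc' => card_blockT_inter m hcc') hkm he he' h

/-! ## 3. Leading exponents of the terms of `D ∘ G_m` and the main theorem -/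

/-- A term `a · ∏_c G_m(c)^{e_c}` with `a ≠ 0` is nonzero. [this file] -/
theorem term_ne_zero (m : ℕ) (e : (Fin 3 → Fin (qOf m)) →₀ ℕ) {a : ℂ} (ha : a ≠ 0) :
    bind₁ (kiPerT m) (monomial e a) ≠ 0 := by
  rw [bind₁_monomial]
  exact mul_ne_zero (C_eq_zero.not.2 ha)
    (Finset.prod_ne_zero_iff.2 fun c _ => pow_ne_zero _ (kiPerT_ne_zero m c))

/-- The lex-leading exponent of the term `a · ∏_c G_m(c)^{e_c}` is `Σ_c e_c • d_c`. [this file] -/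
theorem degree_term (m : ℕ) (e : (Fin 3 → Fin (qOf m)) →₀ ℕ) {a : ℂ} (ha : a ≠ 0) :
    (lexOrd m).degree (bind₁ (kiPerT m) (monomial e a)) = leadSum m e := by
  classical
  have hprod : (∏ c ∈ e.support, kiPerT m c ^ e c) ≠ 0 :=
    Finset.prod_ne_zero_iff.2 fun c _ => pow_ne_zero _ (kiPerT_ne_zero m c)
  rw [bind₁_monomial, (lexOrd m).degree_mul (C_eq_zero.not.2 ha) hprod, (lexOrd m).degree_C, zero_add,
    (lexOrd m).degree_prod (fun c _ => pow_ne_zero _ (kiPerT_ne_zero m c))]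
  simp_rw [(lexOrd m).degree_pow]
  rfl

/-- **Transported main theorem.** [this file] -/
theorem kiPerT_hits_lowDegree {m k : ℕ} (hkm : 2 * k < m) (D : MvPolynomial (Fin 3 → Fin (qOf m)) ℂ)
    (hD : D ≠ 0) (hdeg : D.totalDegree ≤ k) : bind₁ (kiPerT m) D ≠ 0 := by
  classical
  have hne : D.support.Nonempty := Finset.nonempty_iff_ne_empty.2 fun h => hD (support_eq_empty.1 h)
  obtain ⟨e₀, he₀, hmax⟩ := Finset.exists_max_image D.support (fun e => (lexOrd m).toSyn (leadSum m e)) hne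
  have hwt : ∀ e ∈ D.support, (e.sum fun _ n => n) ≤ k := fun e he => (le_totalDegree he).trans hdeg
  have key : coeff (leadSum m e₀) (bind₁ (kiPerT m) D) =
      coeff (leadSum m e₀) (bind₁ (kiPerT m) (monomial e₀ (coeff e₀ D))) := by
    conv_lhs => rw [D.as_sum, map_sum, coeff_sum]
    rw [Finset.sum_eq_single e₀]
    · intro e he hne'
      apply (lexOrd m).coeff_eq_zero_of_lt
      rw [degree_term m e (mem_support_iff.1 he)]
      exact lt_of_le_of_ne (hmax e he) fun h =>
        hne' (leadSum_inj hkm (hwt e he) (hwt e₀ he₀) ((lexOrd m).toSyn.injective h))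
    · intro h
      exact absurd he₀ h
  intro h0
  rw [h0, coeff_zero] at key
  have hT0 := term_ne_zero m e₀ (mem_support_iff.1 he₀)
  apply ((lexOrd m).leadingCoeff_ne_zero_iff.2 hT0)
  show coeff ((lexOrd m).degree _) _ = 0
  rw [degree_term m e₀ (mem_support_iff.1 he₀)]
  exact key.symm

/-- **The low-degree rung (unconditional, kernel).** If `2k < m` then no nonzero polynomial of total degree `≤ k` in the
`q(m)³` coordinate variables annihilates the planted Kabanets–Impagliazzo permanent map `G_m`. [this file] -/
theorem kiPer_hits_lowDegree {m k : ℕ} (hkm : 2 * k < m) (D : MvPolynomial (Fin 3 → Fin (qOf m)) ℂ)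
    (hD : D ≠ 0) (hdeg : D.totalDegree ≤ k) : bind₁ (kiPer m) D ≠ 0 := by
  intro h0
  apply kiPerT_hits_lowDegree hkm D hD hdeg
  have h1 : bind₁ (kiPerT m) D = rename (seedEquiv m) (bind₁ (kiPer m) D) := by
    rw [rename_bind₁]
    rfl
  rw [h1, h0, map_zero]

/-- Eventual form: for every degree bound `k`, for all `m > 2k` the generator `G_m` hits all nonzero polynomials of
total degree `≤ k`. [this file] -/
theorem kiPer_hits_lowDegree_eventually (k : ℕ) : ∃ m₀, ∀ m, m₀ ≤ m →
    ∀ D : MvPolynomial (Fin 3 → Fin (qOf m)) ℂ, D ≠ 0 → D.totalDegree ≤ k → bind₁ (kiPer m) D ≠ 0 :=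
  ⟨2 * k + 1, fun _ hm D hD hdeg => kiPer_hits_lowDegree hm D hD hdeg⟩

end Summit.ValiantsHypothesis.ValiantsHypothesis.Theorems.DefinabilityGapAffineRung

end
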